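import Literature.MathematicalPhysics.QuantumFieldTheory.Balaban1983to89.B9RWSums346SecondDiff
import Literature.MathematicalPhysics.QuantumFieldTheory.Balaban1983to89.B9RWSums346TwoGp

/-!
# `Balaban1983to89.B9RWSums346SecondDiffGp` — [B9] the printed second-order L² members ‖h∇_U∇_UG′(U)λ‖, ‖hG′(U)∇\*_U∇\*_Uλ‖ of (3.46)
# for the random-walk sum (3.90) G′(U), direction-pair indexed: the G′ twin of `B9RWSums346SecondDiff`

T. Bałaban, *Propagators for lattice gauge theories in a background field*, Commun. Math. Phys. **99** (1985) 389–434
[`Balaban1985BackgroundPropagators`, "B9"]; [4] = T. Bałaban, *Propagators and renormalization transformations for lattice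
gauge theories. II*, Commun. Math. Phys. **96** (1984) 223–250 [`Balaban1984PropagatorsII`].

statement-level skeleton of published theorems with citation tags; proofs where landed; nothing here is a claim about the
Yang–Mills mass gap

THE PRINTED LOCI.  (3.46) p. 398 ll. 19–22 (the six L² members, the fourth and sixth being ‖h∇_U∇_UG′(U)λ‖ and ‖hG′(U)∇\*_U∇\*_Uλ‖ —
lit-balaban desk reading of the ×2 renders); (3.88)–(3.90) p. 409 (*"G′ = G′₀(I − R′)⁻¹ = Σ_ω …; the expansion is convergent in all norms
appearing in the inequalities (3.42)–(3.47)"*); p. 410: *"Theorem 3.7 implies that all the inequalities (3.42)–(3.47) hold for G′"*; p. 391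
(L² adjoints); p. 398 ll. 28–31 (∇ ↔ ∇\* licence).

WHY THIS FILE.  The G′ twin of `B9RWSums346SecondDiff` on n06-c's walk datum `B9Thm37Whole.Ops` (the terms of R′ are the ι-indexed
(P_□∇_U + C_□)G′_□h_□, structure (3.88) `Identities.inv ∕ eq388`): direction letters `DirOps37`, schemas `DirTranspose37`, `L2SecondLegs37`,
`FactorsL2Second37`, the per-pair L² block bounds ★ `l2line5_of_local37` (G′∇\*_ν∇\*_μ, right resolvent form + `comp_l2_transfer` at
q = 2) and ★ `l2line3_of_local37` (∇_ν∇_μG′ by adjoint transfer), and the packaged families ★ `blockBd_second_family5_37` ∕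
★ `blockBd_second_family3_37` over `P × P` (`B9RWSums346SecondDiff.familyOp`, `blockBd_familyOp`, `secondConst` by name).

HONEST SCOPE.  Hypothesis schemas of printed shape + kernel bookkeeping; nothing of [B9] or [4] asserted.  NOT a node discharge;
count-neutral; one finite 𝕋^{d+1} programme at fixed ε — nothing continuum, nothing about the mass gap.  Cell `pub-ymgap` (HUMAN RULING
D-0062), Track A node N06 [B9], N06-ASSIGNMENT v1 bundle F6 (rows 18–19), seat `pub-ymgap-dag-n06-k` (gen 8), 2026-08-27.
-/

namespace Literature.MathematicalPhysics.QuantumFieldTheory.Balaban1983to89.B9RWSums346SecondDiffGp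

open Literature.MathematicalPhysics.QuantumFieldTheory.Balaban1983to89
open Finset B6RandomWalk B6RandomWalkHom B9Thm37Sum B9Thm34Ext B9Thm37Glue B9Thm37Whole B9Cor38Whole
open B9RWSums343to347Whole B9RWSums346Schur B9Thm37GlueCor36 B9RWSums343Holder B9RWSums343HolderGp B9RWSums346Lap
open B9RWSums344Input B9RWSums344InputGp B9RWSums346Two B9RWSums346TwoGp B11SectG B9Thm37AllNorms B9SectDL2Decay B9RWSums346SecondDiff

noncomputable section

section GpSide

variable {g : B9.Geometry} [Fintype g.Site] [DecidableEq g.Site] {R : ℝ} {H : Prop} {B : B9.Backgrounds}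
variable {X Y ι P : Type}

/-- ★ **THE DIRECTION LETTERS OF THE WALK DATUM OF (3.90)**: ∇_{U,μ} (`Dd U μ`) and ∇\*_{U,μ} (`Dsd U μ`) in a fixed direction μ ∈ P as
operators on the G′-lattice X (the G′ twin of `DirOps310`).  OURS (letters). [cite: Balaban1985BackgroundPropagators, (3.5)–(3.8) p.392 + (3.46) p.398] -/
structure DirOps37 (𝔬 : Ops g B X Y ι) (P : Type) where
  Dd : B.Cfg → P → Module.End ℝ (X → ℝ)
  Dsd : B.Cfg → P → Module.End ℝ (X → ℝ)

/-- **∇\*_{U,μ} IS THE TRANSPOSE OF ∇_{U,μ}** (p. 391).  A HYPOTHESIS SCHEMA (letter). [cite: Balaban1985BackgroundPropagators, p.391 + (3.8) p.392] -/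
structure DirTranspose37 [Fintype X] (𝔬 : Ops g B X Y ι) (𝔡 : DirOps37 𝔬 P) (U : B.Cfg) : Prop where
  tr : ∀ μ : P, IsTransposePair (𝔡.Dsd U μ) (𝔡.Dd U μ)

/-- **COROLLARY 3.6's SECOND-ORDER L² LINE ‖hG′_□∇\*_U∇\*_Uλ‖ FOR THE HEAD TERMS h_□G′_□(U)h_□ OF (3.90), LOCALIZED, PER DIRECTION PAIR.**
POSITED AS A WHOLE; a HYPOTHESIS SCHEMA, Corollary 3.6 is not asserted. [cite: Balaban1985BackgroundPropagators, Cor. 3.6 p.408 + (3.87) p.409 + (3.46) p.398] -/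
structure L2SecondLegs37 [Fintype X] (𝔬 : Ops g B X Y ι) (𝔡 : DirOps37 𝔬 P) (R : ℝ) (H : Prop) (S3 : ι → Finset g.Site)
    (B3 δ₀ : ℝ) (U : B.Cfg) : Prop where
  l5 : ∀ (i : ι) (ν μ : P), BlockBd (g := toB6 g R H) 𝔬.blk 𝔬.blk
    ((mulOp (𝔬.h i) * 𝔬.Gsq U i * mulOp (𝔬.h i)) ∘ₗ (𝔡.Dsd U ν ∘ₗ 𝔡.Dsd U μ))
    (fun (a b : g.Site) => (if a ∈ S3 i then (1 : ℝ) else 0) * (B3 * Real.exp (-(δ₀ * g.dist a b))))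

/-- **THE TERMS (P_□∇_U + C_□)G′_□(U)h_□∇\*_{U,ν}∇\*_{U,μ} OF R′∇\*∇\* IN THE BLOCK-L² NORMS** ((3.88)–(3.89) p. 409 read against ∇\*∇\* with the
power (Lʲη)⁻²): ‖1_{Δ(y)}(…)μ‖₂ ≦ 1_{S′_□}(y)·θ₃·(Lʲη)⁻²·e^{−δ₀d(y,y′)}‖μ‖₂, supp μ ⊂ Δ(y′).  POSITED; a HYPOTHESIS SCHEMA.
[cite: Balaban1985BackgroundPropagators, (3.88)–(3.89) p.409 + (3.46) p.398; Balaban1984PropagatorsII, (2.40)–(2.44) p.230] -/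
structure FactorsL2Second37 [Fintype X] (𝔬 : Ops g B X Y ι) (𝔡 : DirOps37 𝔬 P) (R : ℝ) (H : Prop) (θ3 δ₀ : ℝ) (U : B.Cfg) :
    Prop where
  facDD : ∀ (i : ι) (ν μ : P), BlockBd (g := toB6 g R H) 𝔬.blk 𝔬.blk
    (((𝔬.P U i ∘ₗ 𝔬.D U + 𝔬.Cop U i) * 𝔬.Gsq U i * mulOp (𝔬.h i)) ∘ₗ (𝔡.Dsd U ν ∘ₗ 𝔡.Dsd U μ))
    (fun (y y' : g.Site) => (if y ∈ 𝔬.S' i then (1 : ℝ) else 0) *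
      (θ3 * g.len y ^ (-2 : ℝ) * Real.exp (-(δ₀ * g.dist y y'))))

omit [Fintype g.Site] [DecidableEq g.Site] in
/-- Algebra of (3.88) read through an operator on the right. [folklore] -/
private theorem right_split' {Y' : Type} {Dst : (Y' → ℝ) →ₗ[ℝ] (X → ℝ)} {G G0 W : Module.End ℝ (X → ℝ)} (h : G = G0 + G * W) :
    G ∘ₗ Dst = G0 ∘ₗ Dst + G ∘ₗ (W ∘ₗ Dst) := by
  conv_lhs => rw [h]
  apply LinearMap.ext
  intro μ
  simp only [LinearMap.comp_apply, LinearMap.add_apply, Module.End.mul_apply]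

omit [DecidableEq g.Site] in
/-- L² block bounds add. [folklore] -/
private theorem blockBd_add'' [Fintype X] {Z : Type} [Fintype Z] (blk₁ : X → g.Site) (blk₂ : Z → g.Site)
    {T₁ T₂ : (X → ℝ) →ₗ[ℝ] (Z → ℝ)} {K₁ K₂ : g.Site → g.Site → ℝ} (h₁ : BlockBd (g := toB6 g R H) blk₁ blk₂ T₁ K₁)
    (h₂ : BlockBd (g := toB6 g R H) blk₁ blk₂ T₂ K₂) :
    BlockBd (g := toB6 g R H) blk₁ blk₂ (T₁ + T₂) (fun a b => K₁ a b + K₂ a b) := by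
  rw [blockBd_iff_hasMaj] at h₁ h₂ ⊢
  exact h₁.add h₂

/-- ★ **THE SIXTH L² MEMBER OF (3.46) FOR THE SUM G′(U) OF (3.90), PER DIRECTION PAIR** — the L² block bound of G′∇\*_{U,ν}∇\*_{U,μ}: (3.88)
G′ = G′₀ + G′R′ (`fixedPoint_of_388`) read on the right as G′∇\*∇\* = G′₀∇\*∇\* + G′(R′∇\*∇\*); the head legs summed with N₃; the sibling's
Schur block bound C·L₀·(Lʲη)² of G′ (`blockBd_entry0`); the terms of R′∇\*∇\* summed with N′; `comp_l2_transfer` at q = 2.  Bound: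
`secondConst d₁ δ₁ α₁ N₃ B₃ N′ θ₃ C L₀`·e^{−(1−2α)δd(y,y′)} provided 2αδ ≦ δ, (1 − 2α)δ ≦ (1 − α₁)δ₁.
[cite: Balaban1985BackgroundPropagators, Thm 3.7 (3.87)–(3.90) pp.408–410 + (3.46) p.398 + p.391; Balaban1984PropagatorsII, (2.52)–(2.55) p.232 + Lemma 2.1 p.234] -/
theorem l2line5_of_local37 [Fintype X] [DecidableEq X] [Fintype ι]
    (𝔬 : Ops g B X Y ι) (𝔡 : DirOps37 𝔬 P) (R : ℝ) (H : Prop) (d d₁ : ℕ) (δ α L₀ δ₁ α₁ ρ N N' Cℓ N3 B3 θ3 C : ℝ) (κ : Sizes)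
    (S3 : ι → Finset g.Site) (U : B.Cfg)
    (hN' : 0 ≤ N') (hN3 : 0 ≤ N3) (hB3 : 0 ≤ B3) (hθ3 : 0 ≤ θ3) (hC : 0 ≤ C)
    (hα2 : 2 * α * δ ≤ δ) (hα₁δ₁ : 0 ≤ α₁ * δ₁) (hrate : (1 - 2 * α) * δ ≤ (1 - α₁) * δ₁)
    (hs : StaticOK 𝔬 ρ N N' Cℓ κ) (hcnt3 : ∀ a : g.Site, (∑ i, if a ∈ S3 i then (1 : ℝ) else 0) ≤ N3)
    (h261 : Ineq261 d₁ (toB6 g R H) δ₁ α₁) (hF : Facts347 g R H d δ α L₀) (hi : Identities 𝔬 R H U)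
    (hL : L2SecondLegs37 𝔬 𝔡 R H S3 B3 δ₁ U) (hFL : FactorsL2Second37 𝔬 𝔡 R H θ3 δ₁ U)
    (h0 : HasMajorant (g := toB6 g R H) 𝔬.blk (𝔬.Gp U) (fun (a b : g.Site) => C * g.len a ^ 2 * Real.exp (-(δ * g.dist a b))))
    (hsym : IsTransposePair (𝔬.Gp U) (𝔬.Gp U)) (ν μ : P) :
    BlockBd (g := toB6 g R H) 𝔬.blk 𝔬.blk (𝔬.Gp U ∘ₗ (𝔡.Dsd U ν ∘ₗ 𝔡.Dsd U μ))
      (fun (a b : g.Site) => secondConst d₁ δ₁ α₁ N3 B3 N' θ3 C L₀ * Real.exp (-((1 - 2 * α) * δ * g.dist a b))) := by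
  have hlen0 : ∀ y : g.Site, 0 ≤ g.len y := fun y => (hs.lenpos y).le
  have htri : Triangle254 (toB6 g R H) := fun a b c => hs.tri a b c
  have hc1 : 0 ≤ B6.c1 d₁ δ₁ α₁ := c1_nonneg d₁ δ₁ α₁
  have hL₀ : 0 ≤ L₀ := le_trans (le_trans zero_le_one hF.one_le_L) hF.L_le
  have hρ'0 : 0 ≤ (1 - 2 * α) * δ := by nlinarith [hα2]
  have hexp : ∀ a b : g.Site, Real.exp (-(δ₁ * g.dist a b)) ≤ Real.exp (-((1 - 2 * α) * δ * g.dist a b)) := fun a b =>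
    Real.exp_le_exp.mpr (neg_le_neg (mul_le_mul_of_nonneg_right (by nlinarith [hrate, hα₁δ₁]) (hs.dnn a b)))
  -- (3.88)
  have hfix : 𝔬.Gp U = (∑ i, mulOp (𝔬.h i) * 𝔬.Gsq U i * mulOp (𝔬.h i)) +
      𝔬.Gp U * ∑ i, (𝔬.P U i ∘ₗ 𝔬.D U + 𝔬.Cop U i) * 𝔬.Gsq U i * mulOp (𝔬.h i) :=
    fixedPoint_of_388 hi.inv hi.eq388
  have hsumE : (∑ i, mulOp (𝔬.h i) * 𝔬.Gsq U i * mulOp (𝔬.h i)) ∘ₗ (𝔡.Dsd U ν ∘ₗ 𝔡.Dsd U μ) =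
      ∑ i, (mulOp (𝔬.h i) * 𝔬.Gsq U i * mulOp (𝔬.h i)) ∘ₗ (𝔡.Dsd U ν ∘ₗ 𝔡.Dsd U μ) := by
    apply LinearMap.ext
    intro f
    simp only [LinearMap.comp_apply, LinearMap.sum_apply]
  have hsumF : (∑ i, (𝔬.P U i ∘ₗ 𝔬.D U + 𝔬.Cop U i) * 𝔬.Gsq U i * mulOp (𝔬.h i)) ∘ₗ (𝔡.Dsd U ν ∘ₗ 𝔡.Dsd U μ) =
      ∑ i, ((𝔬.P U i ∘ₗ 𝔬.D U + 𝔬.Cop U i) * 𝔬.Gsq U i * mulOp (𝔬.h i)) ∘ₗ (𝔡.Dsd U ν ∘ₗ 𝔡.Dsd U μ) := by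
    apply LinearMap.ext
    intro f
    simp only [LinearMap.comp_apply, LinearMap.sum_apply]
  have hP : BlockBd (g := toB6 g R H) 𝔬.blk 𝔬.blk
      ((∑ i, (𝔬.P U i ∘ₗ 𝔬.D U + 𝔬.Cop U i) * 𝔬.Gsq U i * mulOp (𝔬.h i)) ∘ₗ (𝔡.Dsd U ν ∘ₗ 𝔡.Dsd U μ))
      (fun (y y' : g.Site) => N' * θ3 * g.len y ^ (-(2 : ℝ)) * Real.exp (-(δ₁ * g.dist y y'))) := by
    rw [hsumF]
    have h := blockBd_localSum (R := R) (H := H) 𝔬.blk 𝔬.blk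
      (fun i => ((𝔬.P U i ∘ₗ 𝔬.D U + 𝔬.Cop U i) * 𝔬.Gsq U i * mulOp (𝔬.h i)) ∘ₗ (𝔡.Dsd U ν ∘ₗ 𝔡.Dsd U μ))
      (fun i (y : g.Site) => if y ∈ 𝔬.S' i then (1 : ℝ) else 0)
      (fun (y y' : g.Site) => θ3 * g.len y ^ (-2 : ℝ) * Real.exp (-(δ₁ * g.dist y y'))) N'
      (fun y y' => mul_nonneg (mul_nonneg hθ3 (Real.rpow_nonneg (hlen0 y) _)) (Real.exp_nonneg _))
      (fun i => hFL.facDD i ν μ) hs.cnt'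
    exact h.mono fun y y' => le_of_eq (by ring)
  have hS0 := blockBd_entry0 hF hC hs.symm hs.lenpos 𝔬.blk h0 hsym
  have hS : BlockBd (g := toB6 g R H) 𝔬.blk 𝔬.blk (𝔬.Gp U)
      (fun (a b : g.Site) => C * L₀ * g.len a ^ (2 : ℝ) * Real.exp (-((1 - α) * δ * g.dist a b))) :=
    hS0.mono fun a b => by rw [Real.rpow_two]
  have hρ : (1 - α) * δ = α * δ + (1 - 2 * α) * δ := by ring
  have htail := comp_l2_transfer (R := R) (H := H) 𝔬.blk 𝔬.blk 𝔬.blk hF h261 htri hs.symm hs.dnn hs.lenpos (mul_nonneg hC hL₀)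
    (mul_nonneg hN' hθ3) hρ hρ'0 hrate (by rw [abs_two]; norm_num) hS hP
  have hhead := blockBd_localSum (R := R) (H := H) 𝔬.blk 𝔬.blk
    (fun i => (mulOp (𝔬.h i) * 𝔬.Gsq U i * mulOp (𝔬.h i)) ∘ₗ (𝔡.Dsd U ν ∘ₗ 𝔡.Dsd U μ))
    (fun i (a : g.Site) => if a ∈ S3 i then (1 : ℝ) else 0) (fun (a b : g.Site) => B3 * Real.exp (-(δ₁ * g.dist a b))) N3
    (fun a b => mul_nonneg hB3 (Real.exp_nonneg _)) (fun i => hL.l5 i ν μ) hcnt3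
  rw [right_split' hfix, hsumE]
  refine (blockBd_add'' (R := R) (H := H) 𝔬.blk 𝔬.blk hhead htail).mono fun a b => ?_
  have hK0 : 0 ≤ N3 * B3 := mul_nonneg hN3 hB3
  rw [abs_two]
  calc N3 * (B3 * Real.exp (-(δ₁ * g.dist a b))) +
        C * L₀ * (N' * θ3) * L₀ ^ (2 : ℝ) * B6.c1 d₁ δ₁ α₁ * Real.exp (-((1 - 2 * α) * δ * g.dist a b))
      = N3 * B3 * Real.exp (-(δ₁ * g.dist a b)) +
        C * L₀ * (N' * θ3) * L₀ ^ (2 : ℝ) * B6.c1 d₁ δ₁ α₁ * Real.exp (-((1 - 2 * α) * δ * g.dist a b)) := by ring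
    _ ≤ N3 * B3 * Real.exp (-((1 - 2 * α) * δ * g.dist a b)) +
        C * L₀ * (N' * θ3) * L₀ ^ (2 : ℝ) * B6.c1 d₁ δ₁ α₁ * Real.exp (-((1 - 2 * α) * δ * g.dist a b)) :=
        add_le_add (mul_le_mul_of_nonneg_left (hexp a b) hK0) le_rfl
    _ = secondConst d₁ δ₁ α₁ N3 B3 N' θ3 C L₀ * Real.exp (-((1 - 2 * α) * δ * g.dist a b)) := by
        unfold secondConst; ring

/-- ★ **THE FOURTH L² MEMBER OF (3.46) FOR THE SUM G′(U), PER DIRECTION PAIR, BY ADJOINT TRANSFER** — ∇_ν∇_μG′ = (G′∇\*_μ∇\*_ν)ᵀ (G′ symmetric,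
∇\*_κ = ∇_κᵀ), `B9SectDL2Decay.blockBd_of_adjoint`. [cite: Balaban1985BackgroundPropagators, (3.46) p.398 (fourth member) + p.398 ll.28–31 + p.391] -/
theorem l2line3_of_local37 [Fintype X] [DecidableEq X] [Fintype ι]
    (𝔬 : Ops g B X Y ι) (𝔡 : DirOps37 𝔬 P) (R : ℝ) (H : Prop) (d d₁ : ℕ) (δ α L₀ δ₁ α₁ ρ N N' Cℓ N3 B3 θ3 C : ℝ) (κ : Sizes)
    (S3 : ι → Finset g.Site) (U : B.Cfg)
    (hN' : 0 ≤ N') (hN3 : 0 ≤ N3) (hB3 : 0 ≤ B3) (hθ3 : 0 ≤ θ3) (hC : 0 ≤ C)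
    (hα2 : 2 * α * δ ≤ δ) (hα₁δ₁ : 0 ≤ α₁ * δ₁) (hrate : (1 - 2 * α) * δ ≤ (1 - α₁) * δ₁)
    (hs : StaticOK 𝔬 ρ N N' Cℓ κ) (hcnt3 : ∀ a : g.Site, (∑ i, if a ∈ S3 i then (1 : ℝ) else 0) ≤ N3)
    (h261 : Ineq261 d₁ (toB6 g R H) δ₁ α₁) (hF : Facts347 g R H d δ α L₀) (hi : Identities 𝔬 R H U)
    (hL : L2SecondLegs37 𝔬 𝔡 R H S3 B3 δ₁ U) (hFL : FactorsL2Second37 𝔬 𝔡 R H θ3 δ₁ U) (hDT : DirTranspose37 𝔬 𝔡 U)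
    (h0 : HasMajorant (g := toB6 g R H) 𝔬.blk (𝔬.Gp U) (fun (a b : g.Site) => C * g.len a ^ 2 * Real.exp (-(δ * g.dist a b))))
    (hsym : IsTransposePair (𝔬.Gp U) (𝔬.Gp U)) (ν μ : P) :
    BlockBd (g := toB6 g R H) 𝔬.blk 𝔬.blk ((𝔡.Dd U ν ∘ₗ 𝔡.Dd U μ) ∘ₗ 𝔬.Gp U)
      (fun (a b : g.Site) => secondConst d₁ δ₁ α₁ N3 B3 N' θ3 C L₀ * Real.exp (-((1 - 2 * α) * δ * g.dist a b))) := by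
  have h5 := l2line5_of_local37 𝔬 𝔡 R H d d₁ δ α L₀ δ₁ α₁ ρ N N' Cℓ N3 B3 θ3 C κ S3 U hN' hN3 hB3 hθ3 hC hα2 hα₁δ₁ hrate hs
    hcnt3 h261 hF hi hL hFL h0 hsym μ ν
  have hL₀ : 0 ≤ L₀ := le_trans (le_trans zero_le_one hF.one_le_L) hF.L_le
  have hK : 0 ≤ secondConst d₁ δ₁ α₁ N3 B3 N' θ3 C L₀ := secondConst_nonneg hN3 hB3 hN' hθ3 hC hL₀
  have hadj : IsTransposePair (𝔬.Gp U ∘ₗ (𝔡.Dsd U μ ∘ₗ 𝔡.Dsd U ν)) ((𝔡.Dd U ν ∘ₗ 𝔡.Dd U μ) ∘ₗ 𝔬.Gp U) :=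
    ((hDT.tr ν).comp (hDT.tr μ)).comp hsym
  have h := blockBd_of_adjoint (g := toB6 g R H) (blk₁ := 𝔬.blk) (blk₂ := 𝔬.blk) (T := (𝔡.Dd U ν ∘ₗ 𝔡.Dd U μ) ∘ₗ 𝔬.Gp U)
    (T' := 𝔬.Gp U ∘ₗ (𝔡.Dsd U μ ∘ₗ 𝔡.Dsd U ν)) (fun u w => by
      rw [dotProduct, dotProduct]
      exact (hadj u w).symm) h5 (fun y y' => mul_nonneg hK (Real.exp_nonneg _))
  refine h.mono fun y y' => ?_
  rw [hs.symm y' y]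

variable [Fintype P]

/-- ★ **THE PACKAGED FAMILY G′∇\*_{U,ν}∇\*_{U,μ} OVER (ν, μ) ∈ P × P** has the L² block bound |P|·`secondConst …`·e^{−(1−2α)δd} between the fibres
of `blk` and `blk ∘ fst`. [cite: Balaban1985BackgroundPropagators, (3.46) p.398 + (3.39) p.397] -/
theorem blockBd_second_family5_37 [Fintype X] [DecidableEq X] [Fintype ι]
    (𝔬 : Ops g B X Y ι) (𝔡 : DirOps37 𝔬 P) (R : ℝ) (H : Prop) (d d₁ : ℕ) (δ α L₀ δ₁ α₁ ρ N N' Cℓ N3 B3 θ3 C : ℝ) (κ : Sizes)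
    (S3 : ι → Finset g.Site) (U : B.Cfg)
    (hN' : 0 ≤ N') (hN3 : 0 ≤ N3) (hB3 : 0 ≤ B3) (hθ3 : 0 ≤ θ3) (hC : 0 ≤ C)
    (hα2 : 2 * α * δ ≤ δ) (hα₁δ₁ : 0 ≤ α₁ * δ₁) (hrate : (1 - 2 * α) * δ ≤ (1 - α₁) * δ₁)
    (hs : StaticOK 𝔬 ρ N N' Cℓ κ) (hcnt3 : ∀ a : g.Site, (∑ i, if a ∈ S3 i then (1 : ℝ) else 0) ≤ N3)
    (h261 : Ineq261 d₁ (toB6 g R H) δ₁ α₁) (hF : Facts347 g R H d δ α L₀) (hi : Identities 𝔬 R H U)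
    (hL : L2SecondLegs37 𝔬 𝔡 R H S3 B3 δ₁ U) (hFL : FactorsL2Second37 𝔬 𝔡 R H θ3 δ₁ U)
    (h0 : HasMajorant (g := toB6 g R H) 𝔬.blk (𝔬.Gp U) (fun (a b : g.Site) => C * g.len a ^ 2 * Real.exp (-(δ * g.dist a b))))
    (hsym : IsTransposePair (𝔬.Gp U) (𝔬.Gp U)) :
    BlockBd (g := toB6 g R H) 𝔬.blk (𝔬.blk ∘ Prod.fst)
      (familyOp fun p : P × P => 𝔬.Gp U ∘ₗ (𝔡.Dsd U p.1 ∘ₗ 𝔡.Dsd U p.2))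
      (fun (a b : g.Site) => (Fintype.card P : ℝ) * secondConst d₁ δ₁ α₁ N3 B3 N' θ3 C L₀ *
        Real.exp (-((1 - 2 * α) * δ * g.dist a b))) := by
  have hL₀ : 0 ≤ L₀ := le_trans (le_trans zero_le_one hF.one_le_L) hF.L_le
  have hK : 0 ≤ secondConst d₁ δ₁ α₁ N3 B3 N' θ3 C L₀ := secondConst_nonneg hN3 hB3 hN' hθ3 hC hL₀
  have h := blockBd_familyOp (R := R) (H := H) 𝔬.blk 𝔬.blk (P := P × P)
    (T := fun p : P × P => 𝔬.Gp U ∘ₗ (𝔡.Dsd U p.1 ∘ₗ 𝔡.Dsd U p.2))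
    (fun a b => mul_nonneg hK (Real.exp_nonneg _))
    (fun p => l2line5_of_local37 𝔬 𝔡 R H d d₁ δ α L₀ δ₁ α₁ ρ N N' Cℓ N3 B3 θ3 C κ S3 U hN' hN3 hB3 hθ3 hC hα2 hα₁δ₁ hrate hs
      hcnt3 h261 hF hi hL hFL h0 hsym p.1 p.2)
  refine h.mono fun a b => le_of_eq ?_
  rw [Fintype.card_prod, Nat.cast_mul, Real.sqrt_mul_self (Nat.cast_nonneg _)]
  ring

/-- ★ **THE PACKAGED FAMILY ∇_{U,ν}∇_{U,μ}G′ OVER (ν, μ) ∈ P × P** has the L² block bound |P|·`secondConst …`·e^{−(1−2α)δd}.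
[cite: Balaban1985BackgroundPropagators, (3.46) p.398 + (3.39) p.397] -/
theorem blockBd_second_family3_37 [Fintype X] [DecidableEq X] [Fintype ι]
    (𝔬 : Ops g B X Y ι) (𝔡 : DirOps37 𝔬 P) (R : ℝ) (H : Prop) (d d₁ : ℕ) (δ α L₀ δ₁ α₁ ρ N N' Cℓ N3 B3 θ3 C : ℝ) (κ : Sizes)
    (S3 : ι → Finset g.Site) (U : B.Cfg)
    (hN' : 0 ≤ N') (hN3 : 0 ≤ N3) (hB3 : 0 ≤ B3) (hθ3 : 0 ≤ θ3) (hC : 0 ≤ C)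
    (hα2 : 2 * α * δ ≤ δ) (hα₁δ₁ : 0 ≤ α₁ * δ₁) (hrate : (1 - 2 * α) * δ ≤ (1 - α₁) * δ₁)
    (hs : StaticOK 𝔬 ρ N N' Cℓ κ) (hcnt3 : ∀ a : g.Site, (∑ i, if a ∈ S3 i then (1 : ℝ) else 0) ≤ N3)
    (h261 : Ineq261 d₁ (toB6 g R H) δ₁ α₁) (hF : Facts347 g R H d δ α L₀) (hi : Identities 𝔬 R H U)
    (hL : L2SecondLegs37 𝔬 𝔡 R H S3 B3 δ₁ U) (hFL : FactorsL2Second37 𝔬 𝔡 R H θ3 δ₁ U) (hDT : DirTranspose37 𝔬 𝔡 U)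
    (h0 : HasMajorant (g := toB6 g R H) 𝔬.blk (𝔬.Gp U) (fun (a b : g.Site) => C * g.len a ^ 2 * Real.exp (-(δ * g.dist a b))))
    (hsym : IsTransposePair (𝔬.Gp U) (𝔬.Gp U)) :
    BlockBd (g := toB6 g R H) 𝔬.blk (𝔬.blk ∘ Prod.fst)
      (familyOp fun p : P × P => (𝔡.Dd U p.1 ∘ₗ 𝔡.Dd U p.2) ∘ₗ 𝔬.Gp U)
      (fun (a b : g.Site) => (Fintype.card P : ℝ) * secondConst d₁ δ₁ α₁ N3 B3 N' θ3 C L₀ *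
        Real.exp (-((1 - 2 * α) * δ * g.dist a b))) := by
  have hL₀ : 0 ≤ L₀ := le_trans (le_trans zero_le_one hF.one_le_L) hF.L_le
  have hK : 0 ≤ secondConst d₁ δ₁ α₁ N3 B3 N' θ3 C L₀ := secondConst_nonneg hN3 hB3 hN' hθ3 hC hL₀
  have h := blockBd_familyOp (R := R) (H := H) 𝔬.blk 𝔬.blk (P := P × P)
    (T := fun p : P × P => (𝔡.Dd U p.1 ∘ₗ 𝔡.Dd U p.2) ∘ₗ 𝔬.Gp U)
    (fun a b => mul_nonneg hK (Real.exp_nonneg _))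
    (fun p => l2line3_of_local37 𝔬 𝔡 R H d d₁ δ α L₀ δ₁ α₁ ρ N N' Cℓ N3 B3 θ3 C κ S3 U hN' hN3 hB3 hθ3 hC hα2 hα₁δ₁ hrate hs
      hcnt3 h261 hF hi hL hFL hDT h0 hsym p.1 p.2)
  refine h.mono fun a b => le_of_eq ?_
  rw [Fintype.card_prod, Nat.cast_mul, Real.sqrt_mul_self (Nat.cast_nonneg _)]
  ring

end GpSide

end

end Literature.MathematicalPhysics.QuantumFieldTheory.Balaban1983to89.B9RWSums346SecondDiffGp
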